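import Mathlib
import HarnessLib
import HarnessLib.Audit
import Summits.Langlands.Statement
import Summits.Langlands.Langlands.Theses.RootDecomp1
import Summits.Langlands.Langlands.Theses.FunctorialPrimitivitySplit
set_option linter.dupNamespace false
set_option linter.unusedVariables false
set_option linter.unusedSectionVars false

/-!
# Birth skeleton (BC3) for crux `FunctorialPrimitivitySplit.FunctoriallyPrimitiveDark` (REV 1, crit-1 row 295 F1) — line `birth` (PRE-BIRTH form: the cell is a
local def with the route text VERBATIM; after birth replace it by the route decl `Summit.Langlands.Langlands.Theses.FunctorialPrimitivitySplit.FunctoriallyPrimitiveDark`).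
Node `FunctorialPrimitivitySplit` v2 (decomp-langlands lens-2 g21; child route refining `RootDecomp1:SemisimpleAvatar` stmt-Langlands-23598).
Shape: stubs `theorem stub_<name> : <signature> := by sorry` (each a genuine sub-cell — no stub restates the cell, E or the summit:
probes `probes_stubs_FunctoriallyPrimitiveDark.lean`), `namespace _Goal` naming each stub statement, and the kernel-checked composition
`FunctoriallyPrimitiveDark_of (h₁ : _Goal.…) (h₂ : _Goal.…) : <the crux>`.  `lean check --json`: rc 0, sorries = the stubs (2), none elsewhere.
-/

open scoped BigOperators Topology Manifold Classical MeasureTheory ProbabilityTheory Matrix InnerProductSpace ComplexConjugate ContinuousMap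
open Filter Set Function TopologicalSpace MeasureTheory

namespace Summit.Langlands.Langlands.Cruxes.FunctoriallyPrimitiveDark.Birth

/- POST-BIRTH (writer-1 g7): the cell is the route decl `Summit.Langlands.Langlands.Theses.FunctorialPrimitivitySplit.FunctoriallyPrimitiveDark` (stmt-Langlands-28166) BY NAME; the pre-birth local `def FunctoriallyPrimitiveDark` (text VERBATIM = the route statement, sha12 ed3566e3b397) was removed. -/

/-- stub · `stub_darkRankOne` — FPD ∩ «n = 1»: algebraic Hecke characters over ANY number field have ℓ-adic avatars (Weil 1956 / Serre 1968, class field theory) — PRINT, field darkness irrelevant. -/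
theorem stub_darkRankOne :
    ∀ (K : Type) [Field K] [NumberField K] (n : ℕ) (hcpt : Literature.NumberTheory.Automorphic.isCompact_glFiniteIntegralLevel n K), 0 < n → ∀ (π : Literature.NumberTheory.Automorphic.CuspidalAutomorphicRepData n K hcpt), π.1.IsLAlgebraic → ¬ Module.finrank (NumberField.maximalRealSubfield K) K ≤ 2 → n = 1 → ¬ (∃ (k : ℕ) (a : Fin k → ℕ) (hc : ∀ i, Literature.NumberTheory.Automorphic.isCompact_glFiniteIntegralLevel (a i) K) (πs : (i : Fin k) → Literature.NumberTheory.Automorphic.CuspidalAutomorphicRepData (a i) K (hc i)) (r : ((i : Fin k) → Matrix (Fin (a i)) (Fin (a i)) ℂ) → Matrix (Fin n) (Fin n) ℂ), (∀ i, 0 < a i ∧ a i < n) ∧ ((∃ P : Fin n → Fin n → MvPolynomial ((i : Fin k) × (Fin (a i) × Fin (a i))) ℂ, ∀ (M : (i : Fin k) → Matrix (Fin (a i)) (Fin (a i)) ℂ) (s t : Fin n), r M s t = MvPolynomial.eval (fun x => M x.1 x.2.1 x.2.2) (P s t)) ∧ r 1 = 1 ∧ ∀ M N : (i : Fin k) →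 Matrix (Fin (a i)) (Fin (a i)) ℂ, (∀ i, IsUnit (M i)) → (∀ i, IsUnit (N i)) → r (M * N) = r M * r N) ∧ (∀ i, (πs i).1.IsLAlgebraic) ∧ (∀ᶠ v : IsDedekindDomain.HeightOneSpectrum (NumberField.RingOfIntegers K) in cofinite, ∀ α : (i : Fin k) → Fin (a i) → ℂ, (∀ i, (πs i).1.HasSatakeParamAt v (Finset.univ.val.map (α i))) → π.1.HasSatakeParamAt v (r (fun i => Matrix.diagonal (α i))).charpoly.roots)) → ¬ (∃ (L : Type) (_ : Field L) (_ : NumberField L) (_ : Algebra K L) (m : ℕ) (hL : Literature.NumberTheory.Automorphic.isCompact_glFiniteIntegralLevel m L) (σ : Literature.NumberTheory.Automorphic.CuspidalAutomorphicRepData m L hL), 0 < m ∧ m < n ∧ σ.1.IsLAlgebraic ∧ (∀ᶠ v : IsDedekindDomain.HeightOneSpectrum (NumberField.RingOfIntegers K) in cofinite, ∀ β : IsDedekindDomain.HeightOneSpectrum (NumberField.RingOfIntegers L) → Multiset ℂ, (∀ w : IsDedekindDomain.HeightOneSpectrum (NumberField.RingOfIntegers L), w.asIdeal.under (NumberField.RingOfIntegers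 K) = v.asIdeal → σ.1.HasSatakeParamAt w (β w)) → ∃ α : Multiset ℂ, π.1.HasSatakeParamAt v α ∧ Literature.NumberTheory.Automorphic.satakePolynomial α = ∏ᶠ w ∈ {w : IsDedekindDomain.HeightOneSpectrum (NumberField.RingOfIntegers L) | w.asIdeal.under (NumberField.RingOfIntegers K) = v.asIdeal}, (Literature.NumberTheory.Automorphic.satakePolynomial (β w)).comp (Polynomial.X ^ w.asIdeal.inertiaDeg (NumberField.RingOfIntegers K)))) → ¬ (∃ (K₀ : Type) (_ : Field K₀) (_ : NumberField K₀) (_ : Algebra K₀ K) (h₀ : Literature.NumberTheory.Automorphic.isCompact_glFiniteIntegralLevel n K₀) (h₁ : Literature.NumberTheory.Automorphic.isCompact_glFiniteIntegralLevel 1 K) (π₀ : Literature.NumberTheory.Automorphic.CuspidalAutomorphicRepData n K₀ h₀) (χ : Literature.NumberTheory.Automorphic.AutomorphicRepData (Literature.NumberTheory.Automorphic.AutomorphyDatum.gl 1 K h₁)), 2 ≤ Module.finrank K₀ K ∧ π₀.1.IsLAlgebraic ∧ χ.IsLAlgebraic ∧ (∀ᶠ w : IsDedekindDomain.HeightOneSpectrum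 (NumberField.RingOfIntegers K) in cofinite, ∀ (u : IsDedekindDomain.HeightOneSpectrum (NumberField.RingOfIntegers K₀)) (α : Multiset ℂ) (c : ℂ), w.asIdeal.under (NumberField.RingOfIntegers K₀) = u.asIdeal → π₀.1.HasSatakeParamAt u α → χ.HasSatakeParamAt w {c} → π.1.HasSatakeParamAt w ((α.map (· ^ w.asIdeal.inertiaDeg (NumberField.RingOfIntegers K₀))).map (c * ·)))) → ∀ (ℓ : ℕ) [Fact ℓ.Prime] (ι : PadicAlgCl ℓ ≃+* ℂ), ∃ ρ : Literature.NumberTheory.GaloisRepresentations.FramedGaloisRep K (PadicAlgCl ℓ) n, ρ.toGaloisRep.IsSemisimple ∧ ∀ᶠ v : IsDedekindDomain.HeightOneSpectrum (NumberField.RingOfIntegers K) in cofinite, SatakeFrobCompatibleAt ι π.1 ρ v := by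
  sorry

/-- stub · `stub_darkHigherRank` — FPD ∩ «n ≥ 2»: functorially primitive π of rank ≥ 2 over a field with [K:K⁺] ≥ 3 — ShimuraVarietyRealizationBarrier head-on: the core of the core (R1). -/
theorem stub_darkHigherRank :
    ∀ (K : Type) [Field K] [NumberField K] (n : ℕ) (hcpt : Literature.NumberTheory.Automorphic.isCompact_glFiniteIntegralLevel n K), 0 < n → ∀ (π : Literature.NumberTheory.Automorphic.CuspidalAutomorphicRepData n K hcpt), π.1.IsLAlgebraic → ¬ Module.finrank (NumberField.maximalRealSubfield K) K ≤ 2 → 2 ≤ n → ¬ (∃ (k : ℕ) (a : Fin k → ℕ) (hc : ∀ i, Literature.NumberTheory.Automorphic.isCompact_glFiniteIntegralLevel (a i) K) (πs : (i : Fin k) → Literature.NumberTheory.Automorphic.CuspidalAutomorphicRepData (a i) K (hc i)) (r : ((i : Fin k) → Matrix (Fin (a i)) (Fin (a i)) ℂ) → Matrix (Fin n) (Fin n) ℂ), (∀ i, 0 < a i ∧ a i < n) ∧ ((∃ P : Fin n → Fin n → MvPolynomial ((i : Fin k) × (Fin (a i) × Fin (a i))) ℂ, ∀ (M : (i : Fin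 k) → Matrix (Fin (a i)) (Fin (a i)) ℂ) (s t : Fin n), r M s t = MvPolynomial.eval (fun x => M x.1 x.2.1 x.2.2) (P s t)) ∧ r 1 = 1 ∧ ∀ M N : (i : Fin k) → Matrix (Fin (a i)) (Fin (a i)) ℂ, (∀ i, IsUnit (M i)) → (∀ i, IsUnit (N i)) → r (M * N) = r M * r N) ∧ (∀ i, (πs i).1.IsLAlgebraic) ∧ (∀ᶠ v : IsDedekindDomain.HeightOneSpectrum (NumberField.RingOfIntegers K) in cofinite, ∀ α : (i : Fin k) → Fin (a i) → ℂ, (∀ i, (πs i).1.HasSatakeParamAt v (Finset.univ.val.map (α i))) → π.1.HasSatakeParamAt v (r (fun i => Matrix.diagonal (α i))).charpoly.roots)) → ¬ (∃ (L : Type) (_ : Field L) (_ : NumberField L) (_ : Algebra K L) (m : ℕ) (hL : Literature.NumberTheory.Automorphic.isCompact_glFiniteIntegralLevel m L) (σ : Literature.NumberTheory.Automorphic.CuspidalAutomorphicRepData m L hL), 0 < m ∧ m < n ∧ σ.1.IsLAlgebraic ∧ (∀ᶠ v : IsDedekindDomain.HeightOneSpectrum (NumberField.RingOfIntegers K) in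 cofinite, ∀ β : IsDedekindDomain.HeightOneSpectrum (NumberField.RingOfIntegers L) → Multiset ℂ, (∀ w : IsDedekindDomain.HeightOneSpectrum (NumberField.RingOfIntegers L), w.asIdeal.under (NumberField.RingOfIntegers K) = v.asIdeal → σ.1.HasSatakeParamAt w (β w)) → ∃ α : Multiset ℂ, π.1.HasSatakeParamAt v α ∧ Literature.NumberTheory.Automorphic.satakePolynomial α = ∏ᶠ w ∈ {w : IsDedekindDomain.HeightOneSpectrum (NumberField.RingOfIntegers L) | w.asIdeal.under (NumberField.RingOfIntegers K) = v.asIdeal}, (Literature.NumberTheory.Automorphic.satakePolynomial (β w)).comp (Polynomial.X ^ w.asIdeal.inertiaDeg (NumberField.RingOfIntegers K)))) → ¬ (∃ (K₀ : Type) (_ : Field K₀) (_ : NumberField K₀) (_ : Algebra K₀ K) (h₀ : Literature.NumberTheory.Automorphic.isCompact_glFiniteIntegralLevel n K₀) (h₁ : Literature.NumberTheory.Automorphic.isCompact_glFiniteIntegralLevel 1 K) (π₀ : Literature.NumberTheory.Automorphic.CuspidalAutomorphicRepData n K₀ h₀) (χ : Literature.NumberTheory.Automorphic.AutomorphicRepData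 (Literature.NumberTheory.Automorphic.AutomorphyDatum.gl 1 K h₁)), 2 ≤ Module.finrank K₀ K ∧ π₀.1.IsLAlgebraic ∧ χ.IsLAlgebraic ∧ (∀ᶠ w : IsDedekindDomain.HeightOneSpectrum (NumberField.RingOfIntegers K) in cofinite, ∀ (u : IsDedekindDomain.HeightOneSpectrum (NumberField.RingOfIntegers K₀)) (α : Multiset ℂ) (c : ℂ), w.asIdeal.under (NumberField.RingOfIntegers K₀) = u.asIdeal → π₀.1.HasSatakeParamAt u α → χ.HasSatakeParamAt w {c} → π.1.HasSatakeParamAt w ((α.map (· ^ w.asIdeal.inertiaDeg (NumberField.RingOfIntegers K₀))).map (c * ·)))) → ∀ (ℓ : ℕ) [Fact ℓ.Prime] (ι : PadicAlgCl ℓ ≃+* ℂ), ∃ ρ : Literature.NumberTheory.GaloisRepresentations.FramedGaloisRep K (PadicAlgCl ℓ) n, ρ.toGaloisRep.IsSemisimple ∧ ∀ᶠ v : IsDedekindDomain.HeightOneSpectrum (NumberField.RingOfIntegers K) in cofinite, SatakeFrobCompatibleAt ι π.1 ρ v := by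
  sorry

namespace _Goal

/-- statement of `stub_darkRankOne`. -/
def stub_darkRankOne : Prop :=
  ∀ (K : Type) [Field K] [NumberField K] (n : ℕ) (hcpt : Literature.NumberTheory.Automorphic.isCompact_glFiniteIntegralLevel n K), 0 < n → ∀ (π : Literature.NumberTheory.Automorphic.CuspidalAutomorphicRepData n K hcpt), π.1.IsLAlgebraic → ¬ Module.finrank (NumberField.maximalRealSubfield K) K ≤ 2 → n = 1 → ¬ (∃ (k : ℕ) (a : Fin k → ℕ) (hc : ∀ i, Literature.NumberTheory.Automorphic.isCompact_glFiniteIntegralLevel (a i) K) (πs : (i : Fin k) → Literature.NumberTheory.Automorphic.CuspidalAutomorphicRepData (a i) K (hc i)) (r : ((i : Fin k) → Matrix (Fin (a i)) (Fin (a i)) ℂ) → Matrix (Fin n) (Fin n) ℂ), (∀ i, 0 < a i ∧ a i < n) ∧ ((∃ P : Fin n → Fin n → MvPolynomial ((i : Fin k) × (Fin (a i) × Fin (a i))) ℂ, ∀ (M : (i : Fin k) → Matrix (Fin (a i)) (Fin (a i)) ℂ) (s t : Fin n), r M s t = MvPolynomial.eval (fun x => M x.1 x.2.1 x.2.2) (P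 s t)) ∧ r 1 = 1 ∧ ∀ M N : (i : Fin k) → Matrix (Fin (a i)) (Fin (a i)) ℂ, (∀ i, IsUnit (M i)) → (∀ i, IsUnit (N i)) → r (M * N) = r M * r N) ∧ (∀ i, (πs i).1.IsLAlgebraic) ∧ (∀ᶠ v : IsDedekindDomain.HeightOneSpectrum (NumberField.RingOfIntegers K) in cofinite, ∀ α : (i : Fin k) → Fin (a i) → ℂ, (∀ i, (πs i).1.HasSatakeParamAt v (Finset.univ.val.map (α i))) → π.1.HasSatakeParamAt v (r (fun i => Matrix.diagonal (α i))).charpoly.roots)) → ¬ (∃ (L : Type) (_ : Field L) (_ : NumberField L) (_ : Algebra K L) (m : ℕ) (hL : Literature.NumberTheory.Automorphic.isCompact_glFiniteIntegralLevel m L) (σ : Literature.NumberTheory.Automorphic.CuspidalAutomorphicRepData m L hL), 0 < m ∧ m < n ∧ σ.1.IsLAlgebraic ∧ (∀ᶠ v : IsDedekindDomain.HeightOneSpectrum (NumberField.RingOfIntegers K) in cofinite, ∀ β : IsDedekindDomain.HeightOneSpectrum (NumberField.RingOfIntegers L) → Multiset ℂ, (∀ w : IsDedekindDomain.HeightOneSpectrum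 (NumberField.RingOfIntegers L), w.asIdeal.under (NumberField.RingOfIntegers K) = v.asIdeal → σ.1.HasSatakeParamAt w (β w)) → ∃ α : Multiset ℂ, π.1.HasSatakeParamAt v α ∧ Literature.NumberTheory.Automorphic.satakePolynomial α = ∏ᶠ w ∈ {w : IsDedekindDomain.HeightOneSpectrum (NumberField.RingOfIntegers L) | w.asIdeal.under (NumberField.RingOfIntegers K) = v.asIdeal}, (Literature.NumberTheory.Automorphic.satakePolynomial (β w)).comp (Polynomial.X ^ w.asIdeal.inertiaDeg (NumberField.RingOfIntegers K)))) → ¬ (∃ (K₀ : Type) (_ : Field K₀) (_ : NumberField K₀) (_ : Algebra K₀ K) (h₀ : Literature.NumberTheory.Automorphic.isCompact_glFiniteIntegralLevel n K₀) (h₁ : Literature.NumberTheory.Automorphic.isCompact_glFiniteIntegralLevel 1 K) (π₀ : Literature.NumberTheory.Automorphic.CuspidalAutomorphicRepData n K₀ h₀) (χ : Literature.NumberTheory.Automorphic.AutomorphicRepData (Literature.NumberTheory.Automorphic.AutomorphyDatum.gl 1 K h₁)), 2 ≤ Module.finrank K₀ K ∧ π₀.1.IsLAlgebraic ∧ χ.IsLAlgebraic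 ∧ (∀ᶠ w : IsDedekindDomain.HeightOneSpectrum (NumberField.RingOfIntegers K) in cofinite, ∀ (u : IsDedekindDomain.HeightOneSpectrum (NumberField.RingOfIntegers K₀)) (α : Multiset ℂ) (c : ℂ), w.asIdeal.under (NumberField.RingOfIntegers K₀) = u.asIdeal → π₀.1.HasSatakeParamAt u α → χ.HasSatakeParamAt w {c} → π.1.HasSatakeParamAt w ((α.map (· ^ w.asIdeal.inertiaDeg (NumberField.RingOfIntegers K₀))).map (c * ·)))) → ∀ (ℓ : ℕ) [Fact ℓ.Prime] (ι : PadicAlgCl ℓ ≃+* ℂ), ∃ ρ : Literature.NumberTheory.GaloisRepresentations.FramedGaloisRep K (PadicAlgCl ℓ) n, ρ.toGaloisRep.IsSemisimple ∧ ∀ᶠ v : IsDedekindDomain.HeightOneSpectrum (NumberField.RingOfIntegers K) in cofinite, SatakeFrobCompatibleAt ι π.1 ρ v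

/-- statement of `stub_darkHigherRank`. -/
def stub_darkHigherRank : Prop :=
  ∀ (K : Type) [Field K] [NumberField K] (n : ℕ) (hcpt : Literature.NumberTheory.Automorphic.isCompact_glFiniteIntegralLevel n K), 0 < n → ∀ (π : Literature.NumberTheory.Automorphic.CuspidalAutomorphicRepData n K hcpt), π.1.IsLAlgebraic → ¬ Module.finrank (NumberField.maximalRealSubfield K) K ≤ 2 → 2 ≤ n → ¬ (∃ (k : ℕ) (a : Fin k → ℕ) (hc : ∀ i, Literature.NumberTheory.Automorphic.isCompact_glFiniteIntegralLevel (a i) K) (πs : (i : Fin k) → Literature.NumberTheory.Automorphic.CuspidalAutomorphicRepData (a i) K (hc i)) (r : ((i : Fin k) → Matrix (Fin (a i)) (Fin (a i)) ℂ) → Matrix (Fin n) (Fin n) ℂ), (∀ i, 0 < a i ∧ a i < n) ∧ ((∃ P : Fin n → Fin n → MvPolynomial ((i : Fin k) × (Fin (a i) × Fin (a i))) ℂ, ∀ (M : (i : Fin k) → Matrix (Fin (a i)) (Fin (a i)) ℂ) (s t : Fin n), r M s t = MvPolynomial.eval (fun x => M x.1 x.2.1 x.2.2) (P s t)) ∧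 r 1 = 1 ∧ ∀ M N : (i : Fin k) → Matrix (Fin (a i)) (Fin (a i)) ℂ, (∀ i, IsUnit (M i)) → (∀ i, IsUnit (N i)) → r (M * N) = r M * r N) ∧ (∀ i, (πs i).1.IsLAlgebraic) ∧ (∀ᶠ v : IsDedekindDomain.HeightOneSpectrum (NumberField.RingOfIntegers K) in cofinite, ∀ α : (i : Fin k) → Fin (a i) → ℂ, (∀ i, (πs i).1.HasSatakeParamAt v (Finset.univ.val.map (α i))) → π.1.HasSatakeParamAt v (r (fun i => Matrix.diagonal (α i))).charpoly.roots)) → ¬ (∃ (L : Type) (_ : Field L) (_ : NumberField L) (_ : Algebra K L) (m : ℕ) (hL : Literature.NumberTheory.Automorphic.isCompact_glFiniteIntegralLevel m L) (σ : Literature.NumberTheory.Automorphic.CuspidalAutomorphicRepData m L hL), 0 < m ∧ m < n ∧ σ.1.IsLAlgebraic ∧ (∀ᶠ v : IsDedekindDomain.HeightOneSpectrum (NumberField.RingOfIntegers K) in cofinite, ∀ β : IsDedekindDomain.HeightOneSpectrum (NumberField.RingOfIntegers L) → Multiset ℂ, (∀ w : IsDedekindDomain.HeightOneSpectrum (NumberField.RingOfIntegers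 L), w.asIdeal.under (NumberField.RingOfIntegers K) = v.asIdeal → σ.1.HasSatakeParamAt w (β w)) → ∃ α : Multiset ℂ, π.1.HasSatakeParamAt v α ∧ Literature.NumberTheory.Automorphic.satakePolynomial α = ∏ᶠ w ∈ {w : IsDedekindDomain.HeightOneSpectrum (NumberField.RingOfIntegers L) | w.asIdeal.under (NumberField.RingOfIntegers K) = v.asIdeal}, (Literature.NumberTheory.Automorphic.satakePolynomial (β w)).comp (Polynomial.X ^ w.asIdeal.inertiaDeg (NumberField.RingOfIntegers K)))) → ¬ (∃ (K₀ : Type) (_ : Field K₀) (_ : NumberField K₀) (_ : Algebra K₀ K) (h₀ : Literature.NumberTheory.Automorphic.isCompact_glFiniteIntegralLevel n K₀) (h₁ : Literature.NumberTheory.Automorphic.isCompact_glFiniteIntegralLevel 1 K) (π₀ : Literature.NumberTheory.Automorphic.CuspidalAutomorphicRepData n K₀ h₀) (χ : Literature.NumberTheory.Automorphic.AutomorphicRepData (Literature.NumberTheory.Automorphic.AutomorphyDatum.gl 1 K h₁)), 2 ≤ Module.finrank K₀ K ∧ π₀.1.IsLAlgebraic ∧ χ.IsLAlgebraic ∧ (∀ᶠ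 w : IsDedekindDomain.HeightOneSpectrum (NumberField.RingOfIntegers K) in cofinite, ∀ (u : IsDedekindDomain.HeightOneSpectrum (NumberField.RingOfIntegers K₀)) (α : Multiset ℂ) (c : ℂ), w.asIdeal.under (NumberField.RingOfIntegers K₀) = u.asIdeal → π₀.1.HasSatakeParamAt u α → χ.HasSatakeParamAt w {c} → π.1.HasSatakeParamAt w ((α.map (· ^ w.asIdeal.inertiaDeg (NumberField.RingOfIntegers K₀))).map (c * ·)))) → ∀ (ℓ : ℕ) [Fact ℓ.Prime] (ι : PadicAlgCl ℓ ≃+* ℂ), ∃ ρ : Literature.NumberTheory.GaloisRepresentations.FramedGaloisRep K (PadicAlgCl ℓ) n, ρ.toGaloisRep.IsSemisimple ∧ ∀ᶠ v : IsDedekindDomain.HeightOneSpectrum (NumberField.RingOfIntegers K) in cofinite, SatakeFrobCompatibleAt ι π.1 ρ v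

end _Goal

/-- COMPOSITION (kernel-checked, no sorry): the two sub-cells exhaust the crux. -/
theorem FunctoriallyPrimitiveDark_of (h₁ : _Goal.stub_darkRankOne) (h₂ : _Goal.stub_darkHigherRank) : Summit.Langlands.Langlands.Theses.FunctorialPrimitivitySplit.FunctoriallyPrimitiveDark := by
  intro K _ _ n hcpt hn π hπ hacc h1 h2 h3
  rcases Nat.lt_or_ge n 2 with hlt | hge
  · have h1' : n = 1 := by omega
    exact h₁ K n hcpt hn π hπ hacc h1' h1 h2 h3
  · exact h₂ K n hcpt hn π hπ hacc hge h1 h2 h3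

end Summit.Langlands.Langlands.Cruxes.FunctoriallyPrimitiveDark.Birth
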